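import Mathlib
import Literature.NumberTheory.Transcendental.Associators
import Literature.NumberTheory.Transcendental.AssociatorsRegularisation
import HarnessLib

/-!
# Bar elements of `M_{0,5}`: the two-variable multiple polylogarithm functionals (Furusho 2011, §3)

Sibling file of `Associators.lean` (Part B.3 of the proof of `furusho_pentagon_doubleShuffle`
[Furusho2011, Thm 1.2]); everything is proved, no named facts.

Furusho [Furusho2011, §3] works in Brown's variant `V(M_{0,5}) ⊂ T(H¹_DR(M_{0,5}))` of Chen's
reduced bar construction and singles out the elements `l^x_𝐚, l^y_𝐚, l^{xy}_𝐚, l^{x,y}_{𝐚,𝐛},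
l^{y,x}_{𝐚,𝐛}` corresponding to the multiple polylogarithms `Li_𝐚(x), Li_𝐚(y), Li_𝐚(xy),
Li_{𝐚,𝐛}(x,y), Li_{𝐚,𝐛}(y,x)`, expressed in the five 1-forms `α₀ = dx/x, α₁ = dx/(1-x), β₀ = dy/y,
β₁ = dy/(1-y), γ = (x dy + y dx)/(1-xy)` [Furusho2011, Examples 3.2] through the differential
equations of [BF, §5] quoted in [Furusho2011, (3.?) "It satisfies the following differential
equations"]. Here:

* `F5` — the alphabet of the five forms; `BarFun = List F5 → ℤ` — elements of the tensor algebra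
  `T(V₁)` as integer-valued functionals on words (head of the list = leftmost = outermost form of
  Furusho's `[ω_m | ⋯ | ω_1]`); `BarFun.pre`, `BarFun.der` (prefixing / stripping the outermost
  form), the **shuffle product** `BarFun.shuf` (product of `V(M)`, dual to deconcatenation … no:
  the product of iterated integrals), defined by the Leibniz recursion, and `BarFun.swapL`
  (the symmetry `x ↔ y`: `αᵢ ↔ βᵢ`, `γ ↦ γ`).
* `BarFun.lx s, ly s, lxyD s, lxy s t` — the bar elements `l^x, l^y, l^{xy}, l^{x,y}` DEFINED by
  the differential recursions (the tree's index convention is the REVERSE of Furusho's: an index is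
  the list `s = [a_k, …, a_1]`, so his operations on the last index `a_k` act on the head), e.g.
  `lxy (1 :: s') t = α₁ ⊗ lxy s' t - (α₀ + α₁) ⊗ lxy (b₁ :: s') t' + (y-part)` with `t = t' ++ [b₁]`
  [Furusho2011, §3, differential equations]; `l^{y,x}_{s,t} = swapL (lxy s t)`. With `α₁ = dx/(1-x)`
  the signs `(-1)^k` of Furusho's `l_𝐚` are absorbed: `lx s` is the indicator of one word.
* `BarFun.seriesShuffle` — **the series shuffle formula in `V(M_{0,5})`** [Furusho2011, §4,
  (series shuffle for bar)]: `lx s ш ly t = Σ_σ l^{σ(x,y)}_{σ(s,t)}`, the right-hand side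
  `BarFun.Q s t` being organised by the provenance of the head of each quasi-shuffle
  (`BarFun.qshHead`). Furusho derives it from the analytic identity for `Li_𝐚(x) Li_𝐛(y)` through
  the embedding `ρ : V(M_{0,5}) ↪ I_o(M_{0,5})` (Chen); here it is proved combinatorially, by
  induction on the weight, comparing outermost forms (`der`) on both sides.

## References

* H. Furusho, *Double shuffle relation for associators*, Ann. of Math. 174 (2011), 341–360, §3
  (Examples 3.2), §4 (series shuffle formula, Examples 4.1). [Furusho2011]
* A. Besser, H. Furusho, *The double shuffle relations for p-adic multiple zeta values*, Contemp.
  Math. 416 (2006), §5 (differential equations of `Li_{𝐚,𝐛}(x,y)`), cited as [BF] in [Furusho2011].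
-/

namespace Literature.NumberTheory.Transcendental

/-! ## B.3.1 The alphabet and functionals on words -/

/-- The five 1-forms on `M_{0,5}`: `a0 = dx/x`, `a1 = dx/(1-x)`, `b0 = dy/y`, `b1 = dy/(1-y)`,
`g = (x dy + y dx)/(1 - xy)` [Furusho2011, Examples 3.2]. [cite: Furusho2011, §3 Examples 3.2] -/
inductive F5
  | a0 | a1 | b0 | b1 | g
  deriving DecidableEq, Fintype, Repr

/-- Elements of the tensor algebra on the five forms, as integer-valued functionals on words
(`L w` = coefficient of the bar word `[w₁ | ⋯ | w_m]`, `w₁` outermost). [cite: Furusho2011, §3] -/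
abbrev BarFun : Type := List F5 → ℤ

namespace BarFun

open F5

/-- The empty bar word `[]` (unit of the shuffle algebra). [folklore] -/
def unit : BarFun := fun w => if w = [] then 1 else 0

/-- `[]` has coefficient `1` in the unit. [folklore] -/
@[simp] theorem unit_nil : unit [] = 1 := rfl

/-- Nonempty words have coefficient `0` in the unit. [folklore] -/
@[simp] theorem unit_cons (f : F5) (w : List F5) : unit (f :: w) = 0 := rfl

/-- Prefixing by the form `f` (outermost): `pre f L = f ⊗ L`. [folklore] -/
def pre (f : F5) (L : BarFun) : BarFun := fun w =>
  match w with
  | [] => 0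
  | x :: w' => if x = f then L w' else 0

/-- `(f ⊗ L)(∅) = 0`. [folklore] -/
@[simp] theorem pre_nil (f : F5) (L : BarFun) : pre f L [] = 0 := rfl

/-- `(f ⊗ L)(x w) = [x = f] L(w)`. [folklore] -/
theorem pre_cons (f x : F5) (L : BarFun) (w : List F5) :
    pre f L (x :: w) = if x = f then L w else 0 := rfl

/-- Stripping the outermost form: `der f L w = L (f w)` (the component of `L` along `f ⊗ ·`).
[folklore] -/
def der (f : F5) (L : BarFun) : BarFun := fun w => L (f :: w)

/-- `(∂_f L)(w) = L(f w)`. [folklore] -/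
@[simp] theorem der_apply (f : F5) (L : BarFun) (w : List F5) : der f L w = L (f :: w) := rfl

/-- Two functionals agree iff they agree on `[]` and all their components agree. [folklore] -/
theorem ext_der {L L' : BarFun} (h0 : L [] = L' []) (h : ∀ f, der f L = der f L') : L = L' := by
  funext w
  cases w with
  | nil => exact h0
  | cons x w => exact congrFun (h x) w

/-- `∂_f (f ⊗ L) = L`. [folklore] -/
@[simp] theorem der_pre_same (f : F5) (L : BarFun) : der f (pre f L) = L := by
  funext w; simp [pre_cons]

/-- `∂_f (f' ⊗ L) = 0` for `f' ≠ f`. [folklore] -/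
theorem der_pre_of_ne {f f' : F5} (h : f' ≠ f) (L : BarFun) : der f (pre f' L) = 0 := by
  funext w; simp [pre_cons, h.symm]

/-- `∂_f (f' ⊗ L) = [f' = f] L`. [folklore] -/
theorem der_pre (f f' : F5) (L : BarFun) : der f (pre f' L) = if f' = f then L else 0 := by
  split_ifs with h
  · subst h; exact der_pre_same f' L
  · exact der_pre_of_ne h L

/-- `∂_f [] = 0`. [folklore] -/
@[simp] theorem der_unit (f : F5) : der f unit = 0 := rfl

/-- `∂_f 0 = 0`. [folklore] -/
@[simp] theorem der_zero (f : F5) : der f 0 = 0 := rfl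

/-- `∂_f` is additive. [folklore] -/
@[simp] theorem der_add (f : F5) (L L' : BarFun) : der f (L + L') = der f L + der f L' := rfl

/-- `∂_f` respects subtraction. [folklore] -/
@[simp] theorem der_sub (f : F5) (L L' : BarFun) : der f (L - L') = der f L - der f L' := rfl

/-- `∂_f` respects negation. [folklore] -/
@[simp] theorem der_neg (f : F5) (L : BarFun) : der f (-L) = -der f L := rfl

/-- `∂_f` commutes with list sums. [folklore] -/
theorem der_list_sum {ι : Type*} (f : F5) (l : List ι) (G : ι → BarFun) :
    der f (l.map G).sum = (l.map fun i => der f (G i)).sum := by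
  induction l with
  | nil => rfl
  | cons i l ih => simp [ih]

/-- `∂_f` commutes with finite sums. [folklore] -/
theorem der_finset_sum {ι : Type*} (f : F5) (s : Finset ι) (G : ι → BarFun) :
    der f (∑ i ∈ s, G i) = ∑ i ∈ s, der f (G i) := by
  classical
  induction s using Finset.induction_on with
  | empty => rfl
  | insert i s hi ih => rw [Finset.sum_insert hi, Finset.sum_insert hi, der_add, ih]

/-- Evaluation at `∅` commutes with list sums. [folklore] -/
theorem list_sum_apply_nil {ι : Type*} (l : List ι) (G : ι → BarFun) :
    (l.map G).sum [] = (l.map fun i => G i []).sum := by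
  induction l with
  | nil => rfl
  | cons i l ih => simp [ih]

/-- Evaluation at `∅` commutes with finite sums. [folklore] -/
theorem finset_sum_apply_nil {ι : Type*} (s : Finset ι) (G : ι → BarFun) :
    (∑ i ∈ s, G i) [] = ∑ i ∈ s, G i [] := by
  classical
  induction s using Finset.induction_on with
  | empty => rfl
  | insert i s hi ih => rw [Finset.sum_insert hi, Finset.sum_insert hi, Pi.add_apply, ih]

/-- **The shuffle product** of functionals (the product of `V(M)`, i.e. of iterated integrals),
by the Leibniz recursion `(L ш L')(f w) = ((∂_f L) ш L')(w) + (L ш ∂_f L')(w)`,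
`(L ш L')(∅) = L(∅) L'(∅)`. [cite: Furusho2011, §3 ("the product l₁·l₂")] -/
def shuf : BarFun → BarFun → List F5 → ℤ
  | L, L', [] => L [] * L' []
  | L, L', f :: w => shuf (der f L) L' w + shuf L (der f L') w

/-- `(L ш L')(∅) = L(∅) L'(∅)`. [folklore] -/
@[simp] theorem shuf_nil (L L' : BarFun) : shuf L L' [] = L [] * L' [] := rfl

/-- Leibniz rule: `∂_f (L ш L') = ∂_f L ш L' + L ш ∂_f L'`. [folklore] -/
@[simp] theorem der_shuf (f : F5) (L L' : BarFun) :
    der f (shuf L L') = shuf (der f L) L' + shuf L (der f L') := rfl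

/-- The shuffle product is commutative. [folklore] -/
theorem shuf_comm : ∀ (L L' : BarFun), shuf L L' = shuf L' L := by
  suffices h : ∀ (w : List F5) (L L' : BarFun), shuf L L' w = shuf L' L w from
    fun L L' => funext fun w => h w L L'
  intro w
  induction w with
  | nil => intro L L'; simp [mul_comm]
  | cons f w ih => intro L L'; show shuf _ _ _ + shuf _ _ _ = shuf _ _ _ + shuf _ _ _; rw [ih, ih L, add_comm]

/-- The shuffle product is additive in the left factor. [folklore] -/
theorem shuf_add_left : ∀ (L₁ L₂ L' : BarFun), shuf (L₁ + L₂) L' = shuf L₁ L' + shuf L₂ L' := by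
  suffices h : ∀ (w : List F5) (L₁ L₂ L' : BarFun),
      shuf (L₁ + L₂) L' w = shuf L₁ L' w + shuf L₂ L' w from
    fun L₁ L₂ L' => funext fun w => h w L₁ L₂ L'
  intro w
  induction w with
  | nil => intro L₁ L₂ L'; simp [add_mul]
  | cons f w ih =>
    intro L₁ L₂ L'
    show shuf _ _ _ + shuf _ _ _ = (shuf _ _ _ + shuf _ _ _) + (shuf _ _ _ + shuf _ _ _)
    rw [der_add, ih, ih]; abel

/-- `0 ш L' = 0`. [folklore] -/
theorem shuf_zero_left (L' : BarFun) : shuf 0 L' = 0 := by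
  have h := shuf_add_left 0 0 L'
  rw [add_zero] at h
  funext w
  have := congrFun h w
  simp only [Pi.add_apply] at this
  simp only [Pi.zero_apply]
  linarith

/-- `(-L) ш L' = -(L ш L')`. [folklore] -/
theorem shuf_neg_left (L L' : BarFun) : shuf (-L) L' = -shuf L L' := by
  have h := shuf_add_left (-L) L L'
  rw [neg_add_cancel, shuf_zero_left] at h
  funext w
  have := congrFun h w
  simp only [Pi.zero_apply, Pi.add_apply, Pi.neg_apply] at this ⊢
  linarith

/-- The shuffle product respects subtraction on the left. [folklore] -/
theorem shuf_sub_left (L₁ L₂ L' : BarFun) : shuf (L₁ - L₂) L' = shuf L₁ L' - shuf L₂ L' := by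
  rw [sub_eq_add_neg, shuf_add_left, shuf_neg_left, ← sub_eq_add_neg]

/-- `[] ш L = L`. [folklore] -/
theorem shuf_unit_left (L : BarFun) : shuf unit L = L := by
  suffices h : ∀ (w : List F5) (L : BarFun), shuf unit L w = L w from funext fun w => h w L
  intro w
  induction w with
  | nil => intro L; simp
  | cons f w ih => intro L; show shuf _ _ _ + shuf _ _ _ = _; rw [der_unit, ih]; simp [shuf_zero_left]

/-- The letter swap `x ↔ y`: `αᵢ ↔ βᵢ`, `γ ↦ γ`. [cite: Furusho2011, §3] -/
def sw : F5 → F5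
  | a0 => b0
  | a1 => b1
  | b0 => a0
  | b1 => a1
  | g => g

/-- `sw` is an involution. [folklore] -/
@[simp] theorem sw_sw (f : F5) : sw (sw f) = f := by cases f <;> rfl

/-- `sw α₀ = β₀`. [folklore] -/
@[simp] theorem sw_a0 : sw a0 = b0 := rfl
/-- `sw α₁ = β₁`. [folklore] -/
@[simp] theorem sw_a1 : sw a1 = b1 := rfl
/-- `sw β₀ = α₀`. [folklore] -/
@[simp] theorem sw_b0 : sw b0 = a0 := rfl
/-- `sw β₁ = α₁`. [folklore] -/
@[simp] theorem sw_b1 : sw b1 = a1 := rfl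
/-- `sw γ = γ`. [folklore] -/
@[simp] theorem sw_g : sw g = g := rfl

/-- The symmetry `x ↔ y` on functionals: `swapL L w = L (sw w)` (so `l^{y,x} = swapL l^{x,y}`).
[cite: Furusho2011, §3] -/
def swapL (L : BarFun) : BarFun := fun w => L (w.map sw)

/-- `(swapL L)(w) = L(sw w)`. [folklore] -/
@[simp] theorem swapL_apply (L : BarFun) (w : List F5) : swapL L w = L (w.map sw) := rfl

/-- `swapL` is an involution. [folklore] -/
@[simp] theorem swapL_swapL (L : BarFun) : swapL (swapL L) = L := by
  funext w; simp [List.map_map, Function.comp_def]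

/-- `∂_f (swapL L) = swapL (∂_{sw f} L)`. [folklore] -/
theorem der_swapL (f : F5) (L : BarFun) : der f (swapL L) = swapL (der (sw f) L) := rfl

/-- `∂_f L = swapL (∂_{sw f} (swapL L))`. [folklore] -/
theorem der_eq_swapL_der_sw (f : F5) (L : BarFun) : der f L = swapL (der (sw f) (swapL L)) := by
  rw [der_swapL, sw_sw, swapL_swapL]

/-- `swapL (f ⊗ L) = (sw f) ⊗ swapL L`. [folklore] -/
@[simp] theorem swapL_pre (f : F5) (L : BarFun) : swapL (pre f L) = pre (sw f) (swapL L) := by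
  funext w
  cases w with
  | nil => rfl
  | cons x w =>
    simp only [swapL_apply, List.map_cons, pre_cons]
    have : (sw x = f) ↔ (x = sw f) := by cases x <;> cases f <;> simp [sw]
    by_cases hx : x = sw f
    · rw [if_pos (this.mpr hx), if_pos hx]
    · rw [if_neg (mt this.mp hx), if_neg hx]

/-- `swapL [] = []`. [folklore] -/
@[simp] theorem swapL_unit : swapL unit = unit := by
  funext w; cases w <;> simp [unit]

/-- `swapL 0 = 0`. [folklore] -/
@[simp] theorem swapL_zero : swapL 0 = 0 := rfl
/-- `swapL` is additive. [folklore] -/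
@[simp] theorem swapL_add (L L' : BarFun) : swapL (L + L') = swapL L + swapL L' := rfl
/-- `swapL` respects subtraction. [folklore] -/
@[simp] theorem swapL_sub (L L' : BarFun) : swapL (L - L') = swapL L - swapL L' := rfl
/-- `swapL` respects negation. [folklore] -/
@[simp] theorem swapL_neg (L : BarFun) : swapL (-L) = -swapL L := rfl

/-- `swapL` commutes with list sums. [folklore] -/
theorem swapL_list_sum {ι : Type*} (l : List ι) (G : ι → BarFun) :
    swapL (l.map G).sum = (l.map fun i => swapL (G i)).sum := by
  induction l with
  | nil => rfl
  | cons i l ih => simp [ih]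

/-- `swapL` commutes with finite sums. [folklore] -/
theorem swapL_finset_sum {ι : Type*} (s : Finset ι) (G : ι → BarFun) :
    swapL (∑ i ∈ s, G i) = ∑ i ∈ s, swapL (G i) := by
  classical
  induction s using Finset.induction_on with
  | empty => rfl
  | insert i s hi ih => rw [Finset.sum_insert hi, Finset.sum_insert hi, swapL_add, ih]

/-- `swapL` is multiplicative for the shuffle product. [folklore] -/
theorem swapL_shuf (L L' : BarFun) : swapL (shuf L L') = shuf (swapL L) (swapL L') := by
  suffices h : ∀ (w : List F5) (L L' : BarFun), swapL (shuf L L') w = shuf (swapL L) (swapL L') w from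
    funext fun w => h w L L'
  intro w
  induction w with
  | nil => intro L L'; simp
  | cons f w ih =>
    intro L L'
    show shuf _ _ _ + shuf _ _ _ = shuf _ _ _ + shuf _ _ _
    rw [der_swapL, der_swapL, ← ih, ← ih]
    rfl


/-! ## B.3.2 The bar elements `l^x, l^y, l^{xy}, l^{x,y}` by their differential recursions -/

/-- `l^x_s` (one-variable `Li_s(x)` as a bar element in `dx/x, dx/(1-x)`):
`l^x_{c s'} = α₀ ⊗ l^x_{(c-1) s'}` for `c ≥ 2`, `l^x_{1 s'} = α₁ ⊗ l^x_{s'}`, `l^x_∅ = []`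
(`d Li_𝐚 = Li_{𝐚⁻} dz/z` or `Li_{𝐚'} dz/(1-z)`; head of the list = Furusho's last index `a_k`;
a `0` entry gives the junk value `0`). [cite: Furusho2011, §3 (l_𝐚 and its differential equation)] -/
def lx : List ℕ → BarFun
  | [] => unit
  | 0 :: _ => 0
  | 1 :: s' => pre a1 (lx s')
  | (c + 2) :: s' => pre a0 (lx ((c + 1) :: s'))
termination_by s => s.sum + s.length
decreasing_by all_goals simp_wf <;> omega

/-- `l^y_s`: the same in `dy/y, dy/(1-y)`. [cite: Furusho2011, §3] -/
def ly : List ℕ → BarFun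
  | [] => unit
  | 0 :: _ => 0
  | 1 :: s' => pre b1 (ly s')
  | (c + 2) :: s' => pre b0 (ly ((c + 1) :: s'))
termination_by s => s.sum + s.length
decreasing_by all_goals simp_wf <;> omega

/-- `l^{xy}_s` (`Li_s(xy)`): `d Li_𝐚(xy) = Li_{𝐚⁻}(xy) (dx/x + dy/y)` (`a_k ≥ 2`) or
`Li_{𝐚'}(xy) · (x dy + y dx)/(1 - xy)` (`a_k = 1`). [cite: Furusho2011, §3] -/
def lxyD : List ℕ → BarFun
  | [] => unit
  | 0 :: _ => 0
  | 1 :: s' => pre g (lxyD s')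
  | (c + 2) :: s' => pre a0 (lxyD ((c + 1) :: s')) + pre b0 (lxyD ((c + 1) :: s'))
termination_by s => s.sum + s.length
decreasing_by all_goals simp_wf <;> omega

/-- The sum of a list is the sum of its `dropLast` and its last element. [folklore] -/
theorem sum_dropLast_add_getLast (t : List ℕ) (h : t ≠ []) : t.dropLast.sum + t.getLast h = t.sum := by
  conv_rhs => rw [← List.dropLast_append_getLast h]
  rw [List.sum_append, List.sum_singleton]

/-- **`l^{x,y}_{s,t}`** (`Li_{𝐚,𝐛}(x,y)`, `s` = x-indices, `t` = y-indices, heads = Furusho's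
`a_k, b_l`), defined by the differential equations of [BF, §5] as quoted in [Furusho2011, §3]:
writing `t = t' ++ [b₁]`,
`d/dx`: `a_k ≥ 2 ↦ α₀ ⊗ l_{𝐚⁻,𝐛}`; `a_k = 1 ↦ α₁ ⊗ l_{𝐚',𝐛} - (α₀ + α₁) ⊗ l_{(𝐚',b₁),𝐛'}`;
`d/dy`: `b_l ≥ 2 ↦ β₀ ⊗ l_{𝐚,𝐛⁻}`; `b_l = 1 ↦ β₁ ⊗ l_{𝐚,𝐛''}`; with the conventions
`l_{∅,𝐛} = l^y_𝐛`, `l_{𝐚,∅} = l^{xy}_𝐚` (which the printed equations use for `k = 1` / `l = 1`).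
Zero entries give the junk value `0`. [cite: Furusho2011, §3 (differential equations of Li_{𝐚,𝐛})] -/
def lxy : List ℕ → List ℕ → BarFun
  | [], t => ly t
  | c :: s', [] => lxyD (c :: s')
  | 0 :: _, _ :: _ => 0
  | (_ + 1) :: _, 0 :: _ => 0
  | 1 :: s', 1 :: t'' =>
      (pre a1 (lxy s' (1 :: t'')) -
          pre a0 (lxy ((1 :: t'').getLast (List.cons_ne_nil _ _) :: s') (1 :: t'').dropLast) -
          pre a1 (lxy ((1 :: t'').getLast (List.cons_ne_nil _ _) :: s') (1 :: t'').dropLast)) +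
        pre b1 (lxy (1 :: s') t'')
  | 1 :: s', (d + 2) :: t'' =>
      (pre a1 (lxy s' ((d + 2) :: t'')) -
          pre a0 (lxy (((d + 2) :: t'').getLast (List.cons_ne_nil _ _) :: s') ((d + 2) :: t'').dropLast) -
          pre a1 (lxy (((d + 2) :: t'').getLast (List.cons_ne_nil _ _) :: s') ((d + 2) :: t'').dropLast)) +
        pre b0 (lxy (1 :: s') ((d + 1) :: t''))
  | (c + 2) :: s', 1 :: t'' =>
      pre a0 (lxy ((c + 1) :: s') (1 :: t'')) + pre b1 (lxy ((c + 2) :: s') t'')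
  | (c + 2) :: s', (d + 2) :: t'' =>
      pre a0 (lxy ((c + 1) :: s') ((d + 2) :: t'')) + pre b0 (lxy ((c + 2) :: s') ((d + 1) :: t''))
termination_by s t => s.sum + t.sum + s.length + t.length
decreasing_by
  all_goals simp_wf
  all_goals
    first
    | omega
    | (have h := sum_dropLast_add_getLast (1 :: t'') (List.cons_ne_nil _ _)
       rw [List.sum_cons] at h
       omega)
    | (have h := sum_dropLast_add_getLast ((d + 2) :: t'') (List.cons_ne_nil _ _)
       rw [List.sum_cons] at h
       omega)

/-- `l^{y,x}_{s,t} = swapL l^{x,y}_{s,t}` (`Li_{𝐚,𝐛}(y,x)`). [cite: Furusho2011, §3] -/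
abbrev lyx (s t : List ℕ) : BarFun := swapL (lxy s t)

/-! ### Unfolding lemmas -/

/-- `l^x_∅ = []`. [folklore] -/
@[simp] theorem lx_nil : lx [] = unit := by rw [lx]
/-- `l^x_{1 s'} = α₁ ⊗ l^x_{s'}`. [folklore] -/
theorem lx_one (s' : List ℕ) : lx (1 :: s') = pre a1 (lx s') := by rw [lx]
/-- `l^x_{(c+2) s'} = α₀ ⊗ l^x_{(c+1) s'}`. [folklore] -/
theorem lx_two (c : ℕ) (s' : List ℕ) : lx ((c + 2) :: s') = pre a0 (lx ((c + 1) :: s')) := by rw [lx]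

/-- `l^y_∅ = []`. [folklore] -/
@[simp] theorem ly_nil : ly [] = unit := by rw [ly]
/-- `l^y_{1 s'} = β₁ ⊗ l^y_{s'}`. [folklore] -/
theorem ly_one (s' : List ℕ) : ly (1 :: s') = pre b1 (ly s') := by rw [ly]
/-- `l^y_{(c+2) s'} = β₀ ⊗ l^y_{(c+1) s'}`. [folklore] -/
theorem ly_two (c : ℕ) (s' : List ℕ) : ly ((c + 2) :: s') = pre b0 (ly ((c + 1) :: s')) := by rw [ly]

/-- `l^{xy}_∅ = []`. [folklore] -/
@[simp] theorem lxyD_nil : lxyD [] = unit := by rw [lxyD]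
/-- `l^{xy}_{1 s'} = γ ⊗ l^{xy}_{s'}`. [folklore] -/
theorem lxyD_one (s' : List ℕ) : lxyD (1 :: s') = pre g (lxyD s') := by rw [lxyD]
/-- `l^{xy}_{(c+2) s'} = (α₀ + β₀) ⊗ l^{xy}_{(c+1) s'}`. [folklore] -/
theorem lxyD_two (c : ℕ) (s' : List ℕ) :
    lxyD ((c + 2) :: s') = pre a0 (lxyD ((c + 1) :: s')) + pre b0 (lxyD ((c + 1) :: s')) := by
  rw [lxyD]

/-- `l^{x,y}_{∅, t} = l^y_t`. [folklore] -/
@[simp] theorem lxy_nil_left (t : List ℕ) : lxy [] t = ly t := by rw [lxy]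
/-- `l^{x,y}_{s, ∅} = l^{xy}_s` (`s ≠ ∅`). [folklore] -/
@[simp] theorem lxy_nil_right (c : ℕ) (s' : List ℕ) : lxy (c :: s') [] = lxyD (c :: s') := by rw [lxy]
/-- A zero x-index gives the junk value `0`. [folklore] -/
@[simp] theorem lxy_zero_cons (w : List ℕ) (y : ℕ) (q : List ℕ) : lxy (0 :: w) (y :: q) = 0 := by rw [lxy]
/-- A zero y-index gives the junk value `0`. [folklore] -/
@[simp] theorem lxy_succ_zero (c : ℕ) (w : List ℕ) (q : List ℕ) : lxy ((c + 1) :: w) (0 :: q) = 0 := by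
  rw [lxy]
/-- A zero index gives the junk value `0`. [folklore] -/
@[simp] theorem lx_zero (w : List ℕ) : lx (0 :: w) = 0 := by rw [lx]
/-- A zero index gives the junk value `0`. [folklore] -/
@[simp] theorem ly_zero (w : List ℕ) : ly (0 :: w) = 0 := by rw [ly]
/-- A zero index gives the junk value `0`. [folklore] -/
@[simp] theorem lxyD_zero (w : List ℕ) : lxyD (0 :: w) = 0 := by rw [lxyD]

/-- The x-part of the recursion for `a_k = 1` (with `t = t' ++ [b₁]`, `t ≠ ∅`). [folklore] -/
def xPart1 (s' t : List ℕ) (h : t ≠ []) : BarFun :=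
  pre a1 (lxy s' t) - pre a0 (lxy (t.getLast h :: s') t.dropLast) -
    pre a1 (lxy (t.getLast h :: s') t.dropLast)

/-- The recursion for `a_k = 1`, `b_l = 1`. [folklore] -/
theorem lxy_one_one (s' t'' : List ℕ) :
    lxy (1 :: s') (1 :: t'') = xPart1 s' (1 :: t'') (List.cons_ne_nil _ _) + pre b1 (lxy (1 :: s') t'') := by
  rw [lxy, xPart1]

/-- The recursion for `a_k = 1`, `b_l ≥ 2`. [folklore] -/
theorem lxy_one_two (s' : List ℕ) (d : ℕ) (t'' : List ℕ) :
    lxy (1 :: s') ((d + 2) :: t'') =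
      xPart1 s' ((d + 2) :: t'') (List.cons_ne_nil _ _) + pre b0 (lxy (1 :: s') ((d + 1) :: t'')) := by
  rw [lxy, xPart1]

/-- The recursion for `a_k ≥ 2`, `b_l = 1`. [folklore] -/
theorem lxy_two_one (c : ℕ) (s' t'' : List ℕ) :
    lxy ((c + 2) :: s') (1 :: t'') =
      pre a0 (lxy ((c + 1) :: s') (1 :: t'')) + pre b1 (lxy ((c + 2) :: s') t'') := by
  rw [lxy]

/-- The recursion for `a_k ≥ 2`, `b_l ≥ 2`. [folklore] -/
theorem lxy_two_two (c : ℕ) (s' : List ℕ) (d : ℕ) (t'' : List ℕ) :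
    lxy ((c + 2) :: s') ((d + 2) :: t'') =
      pre a0 (lxy ((c + 1) :: s') ((d + 2) :: t'')) + pre b0 (lxy ((c + 2) :: s') ((d + 1) :: t'')) := by
  rw [lxy]

/-! ### Tables of outermost components (`der`) -/

section DerTables

variable (s' t'' : List ℕ) (c d : ℕ)

/-- `l^x_s(∅) = 0` for `s ≠ ∅`. [folklore] -/
@[simp] theorem lx_cons_nil (e : ℕ) (w : List ℕ) : lx ((e + 1) :: w) [] = 0 := by
  rcases e with _ | e
  · rw [lx_one]; rfl
  · rw [lx_two]; rfl

/-- `l^y_s(∅) = 0` for `s ≠ ∅`. [folklore] -/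
@[simp] theorem ly_cons_nil (e : ℕ) (w : List ℕ) : ly ((e + 1) :: w) [] = 0 := by
  rcases e with _ | e
  · rw [ly_one]; rfl
  · rw [ly_two]; rfl

/-- `l^{xy}_s(∅) = 0` for `s ≠ ∅`. [folklore] -/
@[simp] theorem lxyD_cons_nil (e : ℕ) (w : List ℕ) : lxyD ((e + 1) :: w) [] = 0 := by
  rcases e with _ | e
  · rw [lxyD_one]; rfl
  · rw [lxyD_two]; rfl

/-- Components of `l^x_{1 s'}`. [folklore] -/
theorem der_lx_one (f : F5) : der f (lx (1 :: s')) = if f = a1 then lx s' else 0 := by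
  rw [lx_one, der_pre]; cases f <;> simp

/-- Components of `l^x_{(c+2) s'}`. [folklore] -/
theorem der_lx_two (f : F5) : der f (lx ((c + 2) :: s')) = if f = a0 then lx ((c + 1) :: s') else 0 := by
  rw [lx_two, der_pre]; cases f <;> simp

/-- Components of `l^y_{1 s'}`. [folklore] -/
theorem der_ly_one (f : F5) : der f (ly (1 :: s')) = if f = b1 then ly s' else 0 := by
  rw [ly_one, der_pre]; cases f <;> simp

/-- Components of `l^y_{(c+2) s'}`. [folklore] -/
theorem der_ly_two (f : F5) : der f (ly ((c + 2) :: s')) = if f = b0 then ly ((c + 1) :: s') else 0 := by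
  rw [ly_two, der_pre]; cases f <;> simp

/-- Components of `l^{xy}_{1 s'}`. [folklore] -/
theorem der_lxyD_one (f : F5) : der f (lxyD (1 :: s')) = if f = g then lxyD s' else 0 := by
  rw [lxyD_one, der_pre]; cases f <;> simp

/-- Components of `l^{xy}_{(c+2) s'}`. [folklore] -/
theorem der_lxyD_two (f : F5) :
    der f (lxyD ((c + 2) :: s')) = if f = a0 ∨ f = b0 then lxyD ((c + 1) :: s') else 0 := by
  rw [lxyD_two, der_add, der_pre, der_pre]; cases f <;> simp

/-- Components of the x-part for `a_k = 1`. [folklore] -/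
theorem der_xPart1 (f : F5) (t : List ℕ) (h : t ≠ []) :
    der f (xPart1 s' t h) =
      if f = a1 then lxy s' t - lxy (t.getLast h :: s') t.dropLast
      else if f = a0 then -lxy (t.getLast h :: s') t.dropLast else 0 := by
  rw [xPart1, der_sub, der_sub, der_pre, der_pre, der_pre]
  cases f <;> simp

end DerTables

/-! ### Generic component lemmas (all second arguments) -/

section DerLxy

variable (v' : List ℕ) (n : ℕ)

/-- `∂_{α₀} l_{(n+2)v', q} = l_{(n+1)v', q}` for every `q`. [folklore] -/
theorem der_a0_lxy_two : ∀ q : List ℕ, der a0 (lxy ((n + 2) :: v') q) = lxy ((n + 1) :: v') q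
  | [] => by rw [lxy_nil_right, lxy_nil_right, der_lxyD_two]; simp
  | 0 :: q' => by rw [lxy, lxy]; rfl
  | 1 :: q' => by rw [lxy_two_one, der_add, der_pre, der_pre]; simp
  | (d + 2) :: q' => by rw [lxy_two_two, der_add, der_pre, der_pre]; simp

/-- `∂_{α₁} l_{(n+2)v', q} = 0`. [folklore] -/
theorem der_a1_lxy_two : ∀ q : List ℕ, der a1 (lxy ((n + 2) :: v') q) = 0
  | [] => by rw [lxy_nil_right, der_lxyD_two]; simp
  | 0 :: q' => by rw [lxy]; rfl
  | 1 :: q' => by rw [lxy_two_one, der_add, der_pre, der_pre]; simp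
  | (d + 2) :: q' => by rw [lxy_two_two, der_add, der_pre, der_pre]; simp

/-- `∂_{α₀} l_{1 v', (d+1) q'} = - l_{b₁ v', t'}` (`t = (d+1) q' = t' ++ [b₁]`). [folklore] -/
theorem der_a0_lxy_one (d : ℕ) (q' : List ℕ) :
    der a0 (lxy (1 :: v') ((d + 1) :: q')) =
      -lxy (((d + 1) :: q').getLast (List.cons_ne_nil _ _) :: v') ((d + 1) :: q').dropLast := by
  rcases d with _ | d
  · rw [lxy_one_one, der_add, der_xPart1, der_pre]; simp
  · rw [lxy_one_two, der_add, der_xPart1, der_pre]; simp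

/-- `∂_{α₁} l_{1 v', (d+1) q'} = l_{v', t} - l_{b₁ v', t'}`. [folklore] -/
theorem der_a1_lxy_one (d : ℕ) (q' : List ℕ) :
    der a1 (lxy (1 :: v') ((d + 1) :: q')) = lxy v' ((d + 1) :: q') -
      lxy (((d + 1) :: q').getLast (List.cons_ne_nil _ _) :: v') ((d + 1) :: q').dropLast := by
  rcases d with _ | d
  · rw [lxy_one_one, der_add, der_xPart1, der_pre]; simp
  · rw [lxy_one_two, der_add, der_xPart1, der_pre]; simp

/-- `∂_γ l_{v, (d+1) q'} = 0` for every `v`. [folklore] -/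
theorem der_g_lxy_right_succ (d : ℕ) (q' : List ℕ) : ∀ v : List ℕ, der g (lxy v ((d + 1) :: q')) = 0
  | [] => by rcases d with _ | d <;> simp [lxy_nil_left, der_ly_one, der_ly_two]
  | 0 :: _ => by rw [lxy]; rfl
  | 1 :: v' => by
    rcases d with _ | d
    · rw [lxy_one_one, der_add, der_xPart1, der_pre]; simp
    · rw [lxy_one_two, der_add, der_xPart1, der_pre]; simp
  | (n + 2) :: v' => by
    rcases d with _ | d
    · rw [lxy_two_one, der_add, der_pre, der_pre]; simp
    · rw [lxy_two_two, der_add, der_pre, der_pre]; simp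

/-- `∂_{β₀} l_{v, (d+2) q'} = l_{v, (d+1) q'}` for every `v`. [folklore] -/
theorem der_b0_lxy_right_two (d : ℕ) (q' : List ℕ) :
    ∀ v : List ℕ, der b0 (lxy v ((d + 2) :: q')) = lxy v ((d + 1) :: q')
  | [] => by rw [lxy_nil_left, lxy_nil_left, der_ly_two]; simp
  | 0 :: _ => by rw [lxy, lxy]; rfl
  | 1 :: v' => by rw [lxy_one_two, der_add, der_xPart1, der_pre]; simp
  | (n + 2) :: v' => by rw [lxy_two_two, der_add, der_pre, der_pre]; simp

/-- `∂_{β₁} l_{v, (d+2) q'} = 0`. [folklore] -/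
theorem der_b1_lxy_right_two (d : ℕ) (q' : List ℕ) : ∀ v : List ℕ, der b1 (lxy v ((d + 2) :: q')) = 0
  | [] => by rw [lxy_nil_left, der_ly_two]; simp
  | 0 :: _ => by rw [lxy]; rfl
  | 1 :: v' => by rw [lxy_one_two, der_add, der_xPart1, der_pre]; simp
  | (n + 2) :: v' => by rw [lxy_two_two, der_add, der_pre, der_pre]; simp

/-- `∂_{β₀} l_{v, 1 q'} = 0`. [folklore] -/
theorem der_b0_lxy_right_one (q' : List ℕ) : ∀ v : List ℕ, der b0 (lxy v (1 :: q')) = 0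
  | [] => by rw [lxy_nil_left, der_ly_one]; simp
  | 0 :: _ => by rw [lxy]; rfl
  | 1 :: v' => by rw [lxy_one_one, der_add, der_xPart1, der_pre]; simp
  | (n + 2) :: v' => by rw [lxy_two_one, der_add, der_pre, der_pre]; simp

/-- `∂_{β₁} l_{v, 1 q'} = l_{v, q'}` for every `v`. [folklore] -/
theorem der_b1_lxy_right_one (q' : List ℕ) : ∀ v : List ℕ, der b1 (lxy v (1 :: q')) = lxy v q'
  | [] => by rw [lxy_nil_left, lxy_nil_left, der_ly_one]; simp
  | 0 :: w => by
    cases q' with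
    | nil => rw [lxy_zero_cons, lxy_nil_right, lxyD_zero]; rfl
    | cons y q'' => rw [lxy_zero_cons, lxy_zero_cons]; rfl
  | 1 :: v' => by rw [lxy_one_one, der_add, der_xPart1, der_pre]; simp
  | (n + 2) :: v' => by rw [lxy_two_one, der_add, der_pre, der_pre]; simp

/-- Bar elements of positive weight vanish on the empty word: `l_{(e+1) w, (d+1) q'}(∅) = 0`.
[folklore] -/
theorem lxy_succ_succ_nil (e : ℕ) (w : List ℕ) (d : ℕ) (q' : List ℕ) :
    lxy ((e + 1) :: w) ((d + 1) :: q') [] = 0 := by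
  rcases e with _ | e <;> rcases d with _ | d
  · rw [lxy_one_one, xPart1]; rfl
  · rw [lxy_one_two, xPart1]; rfl
  · rw [lxy_two_one]; rfl
  · rw [lxy_two_two]; rfl

end DerLxy

/-! ### The symmetry `x ↔ y` on the bar elements -/

/-- `swapL l^x_s = l^y_s`. [folklore] -/
theorem swapL_lx : ∀ s : List ℕ, swapL (lx s) = ly s
  | [] => by simp
  | 0 :: _ => by rw [lx, ly]; rfl
  | 1 :: s' => by rw [lx_one, ly_one, swapL_pre, swapL_lx s']; rfl
  | (c + 2) :: s' => by rw [lx_two, ly_two, swapL_pre, swapL_lx ((c + 1) :: s')]; rfl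
termination_by s => s.sum + s.length
decreasing_by all_goals simp_wf <;> omega

/-- `swapL l^y_s = l^x_s`. [folklore] -/
theorem swapL_ly (s : List ℕ) : swapL (ly s) = lx s := by
  rw [← swapL_lx, swapL_swapL]

/-- `l^{xy}` is symmetric under `x ↔ y`. [folklore] -/
theorem swapL_lxyD : ∀ s : List ℕ, swapL (lxyD s) = lxyD s
  | [] => by simp
  | 0 :: _ => by rw [lxyD]; rfl
  | 1 :: s' => by rw [lxyD_one, swapL_pre, swapL_lxyD s']; rfl
  | (c + 2) :: s' => by
    rw [lxyD_two, swapL_add, swapL_pre, swapL_pre, swapL_lxyD ((c + 1) :: s'), add_comm]; rfl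
termination_by s => s.sum + s.length
decreasing_by all_goals simp_wf <;> omega

/-! ## B.3.3 The right-hand side of the series shuffle formula -/

open MZV (stuffle)
open NCSeries (splits mem_splits sum_splits_cons sum_splits_eq_sum_range)

/-- The quasi-shuffles of `r` and `q` (Hoffman's `r ∗ q`, `MZV.stuffle`) whose head involves the
head of `r` (unmerged or merged with the head of `q`); as a multiset,
`r ∗ q = qshHead r q + q.head :: (r ∗ q.tail)`. Used to organise the quasi-shuffle terms of the
series shuffle formula by the provenance of their last (Furusho) = first (here) index.
[cite: Furusho2011, §4 (Sh^≤(k,l))] -/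
def qshHead : List ℕ → List ℕ → List (List ℕ)
  | [], _ => []
  | e :: r', [] => [e :: r']
  | e :: r', x :: q' => (stuffle r' (x :: q')).map (List.cons e) ++ (stuffle r' q').map (List.cons (e + x))

/-- `qshHead (e r') [] = [e r']`. [folklore] -/
@[simp] theorem qshHead_cons_nil (e : ℕ) (r' : List ℕ) : qshHead (e :: r') [] = [e :: r'] := rfl

/-- The defining equation of `qshHead` on two nonempty lists. [folklore] -/
theorem qshHead_cons_cons (e : ℕ) (r' : List ℕ) (x : ℕ) (q' : List ℕ) :
    qshHead (e :: r') (x :: q') =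
      (stuffle r' (x :: q')).map (List.cons e) ++ (stuffle r' q').map (List.cons (e + x)) := rfl

/-- `(e r') ∗ (x q')` is `qshHead (e r') (x q')` together with `x :: ((e r') ∗ q')`.
[cite: Hoffman1997, §2 (A3)] -/
theorem stuffle_cons_cons_perm_qshHead (e : ℕ) (r' : List ℕ) (x : ℕ) (q' : List ℕ) :
    (stuffle (e :: r') (x :: q')).Perm
      (qshHead (e :: r') (x :: q') ++ (stuffle (e :: r') q').map (List.cons x)) := by
  rw [MZV.stuffle_cons_cons, qshHead_cons_cons, List.append_assoc]
  exact List.perm_append_comm.append_left _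

/-- Summed form: `Σ_{u ∈ (e r') ∗ (x q')} G u = Σ_{u ∈ qshHead} G u + Σ_{w ∈ (e r') ∗ q'} G (x w)`.
[cite: Hoffman1997, §2 (A3)] -/
theorem sum_stuffle_cons_cons_eq_qshHead {M : Type*} [AddCommMonoid M] (G : List ℕ → M) (e : ℕ)
    (r' : List ℕ) (x : ℕ) (q' : List ℕ) :
    ((stuffle (e :: r') (x :: q')).map G).sum =
      ((qshHead (e :: r') (x :: q')).map G).sum + ((stuffle (e :: r') q').map (G ∘ List.cons x)).sum := by
  rw [((stuffle_cons_cons_perm_qshHead e r' x q').map G).sum_eq, List.map_append, List.sum_append,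
    List.map_map]

/-- Type `(x,y)` terms: `A(s,t) = Σ_{t = q r, q ≠ ∅} Σ_{v ∈ qshHead s r} l^{x,y}_{v,q}` — the
quasi-shuffles of `(𝐚,𝐛)` in which `b_l` is last (here: first), split after `a_k`.
[cite: Furusho2011, §4 (series shuffle formula, σ⁻¹(N) = {k+l})] -/
noncomputable def QA (s t : List ℕ) : BarFun :=
  ∑ p ∈ splits t, if p.1 = [] then 0 else ((qshHead s p.2).map fun v => lxy v p.1).sum

/-- Type `(y,x)` terms: `B(s,t) = Σ_{s = q r, q ≠ ∅} Σ_{v ∈ qshHead t r} l^{y,x}_{v,q}`.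
[cite: Furusho2011, §4 (series shuffle formula, σ⁻¹(N) = {k})] -/
noncomputable def QB (s t : List ℕ) : BarFun :=
  ∑ p ∈ splits s, if p.1 = [] then 0 else ((qshHead t p.2).map fun v => swapL (lxy v p.1)).sum

/-- Type `xy` terms: `C(s,t) = Σ_{w ∈ s' ∗ t''} l^{xy}_{(a_k + b_l) w}` (the heads merged).
[cite: Furusho2011, §4 (series shuffle formula, σ⁻¹(N) = {k, k+l})] -/
def QC : List ℕ → List ℕ → BarFun
  | c :: s', d :: t'' => ((stuffle s' t'').map fun w => lxyD ((c + d) :: w)).sum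
  | _, _ => 0

/-- **The right-hand side of the series shuffle formula** `Σ_{σ ∈ Sh^≤(k,l)} l^{σ(x,y)}_{σ(𝐚,𝐛)}`
[Furusho2011, §4, (series shuffle for bar)], organised by the provenance of the first index of
each quasi-shuffle term. [cite: Furusho2011, §4] -/
noncomputable def Q (s t : List ℕ) : BarFun := QA s t + QB s t + QC s t

/-- `A(s, d t'')` unfolded along the nonempty prefixes `d q` of `t = d t''`. [folklore] -/
theorem QA_cons (s : List ℕ) (d : ℕ) (t'' : List ℕ) :
    QA s (d :: t'') = ∑ p ∈ splits t'', ((qshHead s p.2).map fun v => lxy v (d :: p.1)).sum := by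
  rw [QA, sum_splits_cons]
  simp only [↓reduceIte, reduceCtorEq, zero_add]

/-- `B(c s', t)` unfolded. [folklore] -/
theorem QB_cons (c : ℕ) (s' t : List ℕ) :
    QB (c :: s') t = ∑ p ∈ splits s', ((qshHead t p.2).map fun v => swapL (lxy v (c :: p.1))).sum := by
  rw [QB, sum_splits_cons]
  simp only [↓reduceIte, reduceCtorEq, zero_add]

/-- `C(c s', d t'')` unfolded. [folklore] -/
theorem QC_cons_cons (c : ℕ) (s' : List ℕ) (d : ℕ) (t'' : List ℕ) :
    QC (c :: s') (d :: t'') = ((stuffle s' t'').map fun w => lxyD ((c + d) :: w)).sum := rfl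

/-- The symmetry `x ↔ y` exchanges the type-`(x,y)` and type-`(y,x)` sums. [folklore] -/
theorem swapL_QA (s t : List ℕ) : swapL (QA s t) = QB t s := by
  rw [QA, QB, swapL_finset_sum]
  refine Finset.sum_congr rfl fun p _ => ?_
  split_ifs
  · rfl
  · rw [swapL_list_sum]

/-- The symmetry `x ↔ y` exchanges the type-`(y,x)` and type-`(x,y)` sums. [folklore] -/
theorem swapL_QB (s t : List ℕ) : swapL (QB s t) = QA t s := by
  rw [← swapL_QA, swapL_swapL]

/-- The merged sum is symmetric under `x ↔ y` (commutativity of `∗`). [folklore] -/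
theorem swapL_QC (s t : List ℕ) : swapL (QC s t) = QC t s := by
  match s, t with
  | [], [] => rfl
  | [], _ :: _ => rfl
  | _ :: _, [] => rfl
  | c :: s', d :: t'' =>
    rw [QC_cons_cons, QC_cons_cons, swapL_list_sum, ((MZV.stuffle_perm_comm s' t'').map _).sum_eq,
      Nat.add_comm c d]
    simp only [swapL_lxyD]

/-- **`x ↔ y` symmetry of the right-hand side**: `swapL (Q s t) = Q t s`. [folklore] -/
theorem swapL_Q (s t : List ℕ) : swapL (Q s t) = Q t s := by
  rw [Q, Q, swapL_add, swapL_add, swapL_QA, swapL_QB, swapL_QC]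
  abel


/-! ### Sums over deconcatenations: small lemmas -/

section Splits

variable {M : Type*} [AddCommMonoid M]

/-- `splits [] = {([], [])}` in summed form. [folklore] -/
theorem sum_splits_nil (G : List ℕ × List ℕ → M) : ∑ p ∈ splits ([] : List ℕ), G p = G ([], []) := by
  rw [sum_splits_eq_sum_range]; simp

/-- Only `([], t)` has empty first component. [folklore] -/
theorem sum_splits_ite_fst_nil (t : List ℕ) (A : List ℕ → M) (B : List ℕ × List ℕ → M) :
    ∑ p ∈ splits t, (if p.1 = [] then A p.2 else B p) =
      A t + ∑ p ∈ splits t, (if p.1 = [] then 0 else B p) := by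
  cases t with
  | nil => rw [sum_splits_nil, sum_splits_nil]; simp
  | cons x r => rw [sum_splits_cons, sum_splits_cons]; simp

/-- Only `(t, [])` has empty second component. [folklore] -/
theorem sum_splits_ite_snd_nil (A : List ℕ → M) (B : List ℕ × List ℕ → M) : ∀ t : List ℕ,
    ∑ p ∈ splits t, (if p.2 = [] then A p.1 else B p) =
      A t + ∑ p ∈ splits t, (if p.2 = [] then 0 else B p)
  | [] => by rw [sum_splits_nil, sum_splits_nil]; simp
  | x :: r => by
    rw [sum_splits_cons, sum_splits_cons, if_neg (List.cons_ne_nil x r), if_neg (List.cons_ne_nil x r),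
      sum_splits_ite_snd_nil (fun q => A (x :: q)) (fun p => B (x :: p.1, p.2)) r]
    abel

/-- **Shifting the cut by one**: summing `H(q⁻, last(q) r)` over the cuts `t = q r` with `q ≠ ∅`
is summing `H(q, r)` over the cuts with `r ≠ ∅`. [folklore] -/
theorem sum_splits_shift (H : List ℕ → List ℕ → M) : ∀ t : List ℕ,
    ∑ p ∈ splits t, (if p.1 = [] then 0 else H p.1.dropLast (p.1.getLastD 0 :: p.2)) =
      ∑ p ∈ splits t, (if p.2 = [] then 0 else H p.1 p.2)
  | [] => by rw [sum_splits_nil, sum_splits_nil]; simp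
  | x :: r => by
    rw [sum_splits_cons, sum_splits_cons, if_pos rfl, if_neg (List.cons_ne_nil x r), zero_add]
    dsimp only
    rw [Finset.sum_congr rfl fun (p : List ℕ × List ℕ) _ =>
      if_neg (show ¬ (x :: p.1 = []) from List.cons_ne_nil x p.1)]
    have key : ∀ p ∈ splits r, H (x :: p.1).dropLast ((x :: p.1).getLastD 0 :: p.2) =
        if p.1 = [] then H [] (x :: p.2) else H (x :: p.1.dropLast) (p.1.getLastD 0 :: p.2) := by
      rintro ⟨q, r'⟩ _
      cases q with
      | nil => rfl
      | cons y q' => rfl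
    rw [Finset.sum_congr rfl key, sum_splits_ite_fst_nil r (fun r' => H [] (x :: r'))]
    congr 1
    have h := sum_splits_shift (fun a b => H (x :: a) b) r
    rw [← h]

end Splits

/-! ### Outermost components of the right-hand side -/

section DerQ

variable (s' t'' : List ℕ) (c d : ℕ)

/-- For `a_k ≥ 2`: `∂_{α₀} A((c+2) s', t) = A((c+1) s', t)`. [folklore] -/
theorem der_a0_QA_two (t : List ℕ) : der a0 (QA ((c + 2) :: s') t) = QA ((c + 1) :: s') t := by
  rw [QA, QA, der_finset_sum]
  refine Finset.sum_congr rfl fun p _ => ?_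
  split_ifs with h
  · rfl
  rw [der_list_sum]
  rcases p with ⟨q, r⟩
  cases r with
  | nil => simp [der_a0_lxy_two]
  | cons x r' =>
    simp only [qshHead_cons_cons, List.map_append, List.map_map, List.sum_append, Function.comp_def,
      der_a0_lxy_two, show c + 2 + x = (c + x) + 2 by ring, show c + 1 + x = (c + x) + 1 by ring]

/-- For `a_k ≥ 2`: `∂_{α₀} B((c+2) s', t) = B((c+1) s', t)`. [folklore] -/
theorem der_a0_QB_two (t : List ℕ) : der a0 (QB ((c + 2) :: s') t) = QB ((c + 1) :: s') t := by
  rw [QB_cons, QB_cons, der_finset_sum]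
  refine Finset.sum_congr rfl fun p _ => ?_
  rw [der_list_sum]
  simp only [der_swapL, sw_a0, der_b0_lxy_right_two]

/-- For `a_k ≥ 2`: `∂_{α₀} C((c+2) s', (d+1) t'') = C((c+1) s', (d+1) t'')`. [folklore] -/
theorem der_a0_QC_two : der a0 (QC ((c + 2) :: s') ((d + 1) :: t'')) = QC ((c + 1) :: s') ((d + 1) :: t'') := by
  rw [QC_cons_cons, QC_cons_cons, der_list_sum]
  simp only [show c + 2 + (d + 1) = (c + d + 1) + 2 by ring, show c + 1 + (d + 1) = (c + d + 1) + 1 by ring,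
    der_lxyD_two, true_or, ↓reduceIte]

/-- `∂_{α₀} Q((c+2) s', (d+1) t'') = Q((c+1) s', (d+1) t'')`. [folklore] -/
theorem der_a0_Q_two : der a0 (Q ((c + 2) :: s') ((d + 1) :: t'')) = Q ((c + 1) :: s') ((d + 1) :: t'') := by
  rw [Q, Q, der_add, der_add, der_a0_QA_two, der_a0_QB_two, der_a0_QC_two]

/-- The family `H(q, y r) = Σ_{v' ∈ s' ∗ r} l_{y v', q}` (and `H(q, ∅) = 0`) indexing both
cancelling sums for `a_k = 1`. [folklore] -/
noncomputable def HF (s' q r : List ℕ) : BarFun :=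
  match r with
  | [] => 0
  | y :: r'' => ((stuffle s' r'').map fun v' => lxy (y :: v') q).sum

/-- `H(q, ∅) = 0`. [folklore] -/
@[simp] theorem HF_nil (s' q : List ℕ) : HF s' q [] = 0 := rfl

/-- `H(q, y r'')` unfolded. [folklore] -/
theorem HF_cons (s' q : List ℕ) (y : ℕ) (r'' : List ℕ) :
    HF s' q (y :: r'') = ((stuffle s' r'').map fun v' => lxy (y :: v') q).sum := rfl

/-- List sums commute with negation. [folklore] -/
theorem list_sum_map_neg {ι : Type*} (l : List ι) (G : ι → BarFun) :
    (l.map fun i => -G i).sum = -(l.map G).sum := by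
  induction l with
  | nil => simp
  | cons i l ih => simp [ih]; abel

/-- List sums are additive. [folklore] -/
theorem list_sum_map_add {ι : Type*} (l : List ι) (G G' : ι → BarFun) :
    (l.map fun i => G i + G' i).sum = (l.map G).sum + (l.map G').sum := by
  induction l with
  | nil => simp
  | cons i l ih => simp [ih]; abel

/-- List sums respect subtraction. [folklore] -/
theorem list_sum_map_sub {ι : Type*} (l : List ι) (G G' : ι → BarFun) :
    (l.map fun i => G i - G' i).sum = (l.map G).sum - (l.map G').sum := by
  induction l with
  | nil => simp
  | cons i l ih => simp [ih]; abel

/-- An element of the second component of a cut of `t''` lies in `t''`. [folklore] -/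
theorem mem_of_mem_splits_snd {t'' : List ℕ} {p : List ℕ × List ℕ} (hp : p ∈ splits t'') {x : ℕ}
    (hx : x ∈ p.2) : x ∈ t'' := by
  rw [mem_splits] at hp
  rw [← hp]
  exact List.mem_append_right _ hx

/-- An element of the first component of a cut of `t''` lies in `t''`. [folklore] -/
theorem mem_of_mem_splits_fst {t'' : List ℕ} {p : List ℕ × List ℕ} (hp : p ∈ splits t'') {x : ℕ}
    (hx : x ∈ p.1) : x ∈ t'' := by
  rw [mem_splits] at hp
  rw [← hp]
  exact List.mem_append_left _ hx

/-- **The shifted family**: `Σ_{cuts of t''} H((d q)⁻, last(d q) r) = H(∅, d t'') + Σ_{cuts} H(d q, r)`.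
[folklore] -/
theorem sum_splits_HF_shift :
    ∑ p ∈ splits t'', HF s' ((d + 1) :: p.1).dropLast (((d + 1) :: p.1).getLastD 0 :: p.2) =
      HF s' [] ((d + 1) :: t'') + ∑ p ∈ splits t'', HF s' ((d + 1) :: p.1) p.2 := by
  have hshift := sum_splits_shift (HF s') ((d + 1) :: t'')
  rw [sum_splits_cons, if_pos rfl, zero_add, sum_splits_cons, if_neg (List.cons_ne_nil _ _)] at hshift
  simp only [reduceCtorEq, ↓reduceIte] at hshift
  rw [hshift]
  congr 1
  refine Finset.sum_congr rfl fun p _ => ?_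
  split_ifs with h
  · rw [h, HF_nil]
  · rfl

/-- Components along the cuts, for `a_k = 1`: `∂_{α₀}` of the `qshHead` sum at the cut `(q, r)`.
[folklore] -/
theorem der_a0_qshHead_sum_one (ht : ∀ i ∈ t'', 1 ≤ i) (p : List ℕ × List ℕ) (hp : p ∈ splits t'') :
    der a0 (((qshHead (1 :: s') p.2).map fun v => lxy v ((d + 1) :: p.1)).sum) =
      -HF s' ((d + 1) :: p.1).dropLast (((d + 1) :: p.1).getLastD 0 :: p.2) + HF s' ((d + 1) :: p.1) p.2 := by
  rcases p with ⟨q, r⟩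
  rw [der_list_sum]
  cases r with
  | nil =>
    simp only [qshHead_cons_nil, List.map_cons, List.map_nil, List.sum_cons, List.sum_nil, add_zero,
      der_a0_lxy_one, HF_nil, HF_cons, MZV.stuffle_nil_right]
    rfl
  | cons x r' =>
    have hx : 1 ≤ x := ht x (mem_of_mem_splits_snd hp (by simp))
    obtain ⟨x', rfl⟩ : ∃ x', x = x' + 1 := ⟨x - 1, by omega⟩
    simp only [qshHead_cons_cons, List.map_append, List.map_map, List.sum_append, Function.comp_def,
      show 1 + (x' + 1) = x' + 2 by ring, der_a0_lxy_two, der_a0_lxy_one, list_sum_map_neg, HF_cons]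
    rfl

/-- For `a_k = 1`: `∂_{α₀} A(1 s', d t'') = - Σ_{v' ∈ s' ∗ t''} l^{xy}_{d v'}` (the two families
cancel after shifting the cut, except for the cut `(∅, t)`), for `t''` with positive entries.
[folklore] -/
theorem der_a0_QA_one (ht : ∀ i ∈ t'', 1 ≤ i) :
    der a0 (QA (1 :: s') ((d + 1) :: t'')) = -((stuffle s' t'').map fun v' => lxyD ((d + 1) :: v')).sum := by
  rw [QA_cons, der_finset_sum, Finset.sum_congr rfl (der_a0_qshHead_sum_one s' t'' d ht),
    Finset.sum_add_distrib, Finset.sum_neg_distrib, sum_splits_HF_shift s' t'' d, HF_cons]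
  simp only [lxy_nil_right]
  abel

/-- For `a_k = 1`: `∂_{α₀} B(1 s', t) = 0`. [folklore] -/
theorem der_a0_QB_one (t : List ℕ) : der a0 (QB (1 :: s') t) = 0 := by
  rw [QB_cons, der_finset_sum]
  refine Finset.sum_eq_zero fun p _ => ?_
  rw [der_list_sum]
  simp only [der_swapL, sw_a0, der_b0_lxy_right_one, swapL_zero, List.map_const', List.sum_replicate,
    smul_zero]

/-- For `a_k = 1`: `∂_{α₀} C(1 s', (d+1) t'') = Σ_{w ∈ s' ∗ t''} l^{xy}_{(d+1) w}`. [folklore] -/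
theorem der_a0_QC_one :
    der a0 (QC (1 :: s') ((d + 1) :: t'')) = ((stuffle s' t'').map fun w => lxyD ((d + 1) :: w)).sum := by
  rw [QC_cons_cons, der_list_sum]
  simp only [show 1 + (d + 1) = d + 2 by ring, der_lxyD_two, true_or, ↓reduceIte]

/-- **`∂_{α₀} Q(1 s', t) = 0`** (the type-`(x,y)` terms with `a_k = 1` unmerged cancel against the
merged ones). [folklore] -/
theorem der_a0_Q_one (ht : ∀ i ∈ t'', 1 ≤ i) : der a0 (Q (1 :: s') ((d + 1) :: t'')) = 0 := by
  rw [Q, der_add, der_add, der_a0_QA_one s' t'' d ht, der_a0_QB_one, der_a0_QC_one, add_zero,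
    neg_add_cancel]

/-- For `a_k ≥ 2`: `∂_{α₁} Q((c+2) s', (d+1) t'') = 0`. [folklore] -/
theorem der_a1_Q_two : der a1 (Q ((c + 2) :: s') ((d + 1) :: t'')) = 0 := by
  rw [Q, der_add, der_add, QA, QB_cons, QC_cons_cons, der_finset_sum, der_finset_sum, der_list_sum]
  have hA : ∀ p ∈ splits ((d + 1) :: t''),
      der a1 (if p.1 = [] then (0 : BarFun) else ((qshHead ((c + 2) :: s') p.2).map fun v => lxy v p.1).sum) = 0 := by
    rintro ⟨q, r⟩ _
    split_ifs
    · rfl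
    rw [der_list_sum]
    cases r with
    | nil => simp [der_a1_lxy_two]
    | cons x r' =>
      simp only [qshHead_cons_cons, List.map_append, List.map_map, List.sum_append, Function.comp_def,
        show c + 2 + x = (c + x) + 2 by ring, der_a1_lxy_two, List.map_const', List.sum_replicate,
        smul_zero, add_zero]
  rw [Finset.sum_congr rfl hA, Finset.sum_const_zero, zero_add]
  have hB : ∀ p ∈ splits s',
      der a1 (((qshHead ((d + 1) :: t'') p.2).map fun v => swapL (lxy v ((c + 2) :: p.1))).sum) = 0 := by
    intro p _
    rw [der_list_sum]
    simp only [der_swapL, sw_a1, der_b1_lxy_right_two, swapL_zero, List.map_const', List.sum_replicate,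
      smul_zero]
  rw [Finset.sum_congr rfl hB, Finset.sum_const_zero, zero_add]
  simp only [show c + 2 + (d + 1) = (c + d + 1) + 2 by ring, der_lxyD_two]
  simp

/-- Components along the cuts, for `a_k = 1`: `∂_{α₁}` of the `qshHead` sum at the cut `(q, r)`.
[folklore] -/
theorem der_a1_qshHead_sum_one (ht : ∀ i ∈ t'', 1 ≤ i) (p : List ℕ × List ℕ) (hp : p ∈ splits t'') :
    der a1 (((qshHead (1 :: s') p.2).map fun v => lxy v ((d + 1) :: p.1)).sum) =
      ((stuffle s' p.2).map fun v' => lxy v' ((d + 1) :: p.1)).sum -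
        HF s' ((d + 1) :: p.1).dropLast (((d + 1) :: p.1).getLastD 0 :: p.2) := by
  rcases p with ⟨q, r⟩
  rw [der_list_sum]
  cases r with
  | nil =>
    simp only [qshHead_cons_nil, List.map_cons, List.map_nil, List.sum_cons, List.sum_nil, add_zero,
      der_a1_lxy_one, HF_cons, MZV.stuffle_nil_right]
    rfl
  | cons x r' =>
    have hx : 1 ≤ x := ht x (mem_of_mem_splits_snd hp (by simp))
    obtain ⟨x', rfl⟩ : ∃ x', x = x' + 1 := ⟨x - 1, by omega⟩
    simp only [qshHead_cons_cons, List.map_append, List.map_map, List.sum_append, Function.comp_def,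
      show 1 + (x' + 1) = x' + 2 by ring, der_a1_lxy_two, der_a1_lxy_one, list_sum_map_sub, HF_cons,
      List.map_const', List.sum_replicate, smul_zero, add_zero]
    rfl

/-- Along a cut `(q, r)`: `Σ_{v' ∈ s' ∗ r} l_{v', dq} = Σ_{v ∈ qshHead s' r} l_{v, dq} + H(dq, r)` for
`s' ≠ ∅`. [folklore] -/
theorem sum_stuffle_lxy_eq_qshHead_add_HF (c' : ℕ) (s'' q r : List ℕ) :
    ((stuffle (c' :: s'') r).map fun v' => lxy v' ((d + 1) :: q)).sum =
      ((qshHead (c' :: s'') r).map fun v => lxy v ((d + 1) :: q)).sum + HF (c' :: s'') ((d + 1) :: q) r := by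
  cases r with
  | nil => simp
  | cons x r' => rw [sum_stuffle_cons_cons_eq_qshHead, HF_cons]; rfl

/-- For `a_k = 1`, `𝐚' ≠ ∅`: `∂_{α₁} A(1 c' s'', d t'') = A(c' s'', d t'') - Σ_{v' ∈ s' ∗ t''} l^{xy}_{d v'}`.
[folklore] -/
theorem der_a1_QA_one_cons (ht : ∀ i ∈ t'', 1 ≤ i) (c' : ℕ) (s'' : List ℕ) :
    der a1 (QA (1 :: c' :: s'') ((d + 1) :: t'')) =
      QA (c' :: s'') ((d + 1) :: t'') - ((stuffle (c' :: s'') t'').map fun v' => lxyD ((d + 1) :: v')).sum := by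
  rw [QA_cons, der_finset_sum, Finset.sum_congr rfl (der_a1_qshHead_sum_one (c' :: s'') t'' d ht),
    Finset.sum_sub_distrib, sum_splits_HF_shift (c' :: s'') t'' d, HF_cons, QA_cons]
  simp only [sum_stuffle_lxy_eq_qshHead_add_HF, Finset.sum_add_distrib, lxy_nil_right]
  abel

/-- For `a_k = 1`, `𝐚' = ∅`: `∂_{α₁} A(1, d t'') = l^y_{d t''} - l^{xy}_{d t''}` (telescoping over the
cuts). [folklore] -/
theorem der_a1_QA_one_nil (ht : ∀ i ∈ t'', 1 ≤ i) :
    der a1 (QA [1] ((d + 1) :: t'')) = ly ((d + 1) :: t'') - lxyD ((d + 1) :: t'') := by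
  rw [QA_cons, der_finset_sum, Finset.sum_congr rfl (der_a1_qshHead_sum_one [] t'' d ht),
    Finset.sum_sub_distrib, sum_splits_HF_shift [] t'' d, HF_cons]
  simp only [MZV.stuffle_nil_left, List.map_cons, List.map_nil, List.sum_cons, List.sum_nil, add_zero,
    lxy_nil_right]
  -- Σ_{cuts (q,r) of t''} l_{r, dq} = l_{∅, t} + Σ_{cuts, r ≠ ∅} H([], dq, r)
  have hsum : ∑ p ∈ splits t'', lxy p.2 ((d + 1) :: p.1) =
      ly ((d + 1) :: t'') + ∑ p ∈ splits t'', HF [] ((d + 1) :: p.1) p.2 := by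
    have key : ∀ p ∈ splits t'', lxy p.2 ((d + 1) :: p.1) =
        if p.2 = [] then lxy [] ((d + 1) :: p.1) else HF [] ((d + 1) :: p.1) p.2 := by
      rintro ⟨q, r⟩ _
      cases r with
      | nil => rfl
      | cons x r' => simp [HF_cons]
    rw [Finset.sum_congr rfl key, sum_splits_ite_snd_nil (fun q => lxy [] ((d + 1) :: q))
      (fun p => HF [] ((d + 1) :: p.1) p.2) t'', lxy_nil_left]
    congr 1
    refine Finset.sum_congr rfl fun p _ => ?_
    split_ifs with h
    · rw [h, HF_nil]
    · rfl
  rw [hsum]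
  abel

/-- For `a_k = 1`: `∂_{α₁} B(1 s', t) = Σ_{cuts (q,r) of s'} Σ_{v ∈ qshHead t r} l^{y,x}_{v,q}`. [folklore] -/
theorem der_a1_QB_one (t : List ℕ) :
    der a1 (QB (1 :: s') t) = ∑ p ∈ splits s', ((qshHead t p.2).map fun v => swapL (lxy v p.1)).sum := by
  rw [QB_cons, der_finset_sum]
  refine Finset.sum_congr rfl fun p _ => ?_
  rw [der_list_sum]
  simp only [der_swapL, sw_a1, der_b1_lxy_right_one]

/-- For `a_k = 1`: `∂_{α₁} C(1 s', t) = 0`. [folklore] -/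
theorem der_a1_QC_one : der a1 (QC (1 :: s') ((d + 1) :: t'')) = 0 := by
  rw [QC_cons_cons, der_list_sum]
  simp only [show 1 + (d + 1) = d + 2 by ring, der_lxyD_two]
  simp

/-- **`∂_{α₁} Q([1], t) = l^y_t`**. [folklore] -/
theorem der_a1_Q_one_nil (ht : ∀ i ∈ t'', 1 ≤ i) : der a1 (Q [1] ((d + 1) :: t'')) = ly ((d + 1) :: t'') := by
  rw [Q, der_add, der_add, der_a1_QA_one_nil t'' d ht, der_a1_QB_one, der_a1_QC_one, sum_splits_nil]
  simp only [qshHead_cons_nil, List.map_cons, List.map_nil, List.sum_cons, List.sum_nil, add_zero,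
    lxy_nil_right, swapL_lxyD]
  abel

/-- **`∂_{α₁} Q(1 s', t) = Q(s', t)`** for `s' ≠ ∅` (with positive entries). [folklore] -/
theorem der_a1_Q_one_cons (ht : ∀ i ∈ t'', 1 ≤ i) (c' : ℕ) (s'' : List ℕ) :
    der a1 (Q (1 :: (c' + 1) :: s'') ((d + 1) :: t'')) = Q ((c' + 1) :: s'') ((d + 1) :: t'') := by
  rw [Q, der_add, der_add, der_a1_QA_one_cons t'' d ht, der_a1_QB_one, der_a1_QC_one, add_zero,
    sum_splits_cons, ← QB_cons, Q, QC_cons_cons, qshHead_cons_cons]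
  simp only [List.map_append, List.map_map, List.sum_append, Function.comp_def, lxy_nil_right,
    swapL_lxyD]
  rw [MZV.sum_map_stuffle_comm (fun w => lxyD ((d + 1) :: w)) t'' ((c' + 1) :: s''),
    MZV.sum_map_stuffle_comm (fun w => lxyD ((d + 1 + (c' + 1)) :: w)) t'' s'',
    show d + 1 + (c' + 1) = c' + 1 + (d + 1) by ring]
  abel

/-- **`∂_γ Q(s, t) = 0`** (no `γ` on the outside). [folklore] -/
theorem der_g_Q (s' : List ℕ) : der g (Q ((c + 1) :: s') ((d + 1) :: t'')) = 0 := by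
  rw [Q, der_add, der_add, QA_cons, QB_cons, QC_cons_cons, der_finset_sum, der_finset_sum, der_list_sum]
  have hA : ∀ p ∈ splits t'',
      der g (((qshHead ((c + 1) :: s') p.2).map fun v => lxy v ((d + 1) :: p.1)).sum) = 0 := by
    intro p _
    rw [der_list_sum]
    simp only [der_g_lxy_right_succ, List.map_const', List.sum_replicate, smul_zero]
  have hB : ∀ p ∈ splits s',
      der g (((qshHead ((d + 1) :: t'') p.2).map fun v => swapL (lxy v ((c + 1) :: p.1))).sum) = 0 := by
    intro p _
    rw [der_list_sum]
    simp only [der_swapL, sw_g, der_g_lxy_right_succ, swapL_zero, List.map_const', List.sum_replicate,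
      smul_zero]
  rw [Finset.sum_congr rfl hA, Finset.sum_congr rfl hB, Finset.sum_const_zero, Finset.sum_const_zero,
    zero_add, zero_add]
  simp only [show c + 1 + (d + 1) = (c + d) + 2 by ring, der_lxyD_two]
  simp

end DerQ

/-! ## B.3.4 The series shuffle formula -/

/-- `l^x_s(∅) = 0` for `s ≠ ∅`. [folklore] -/
theorem lx_succ_cons_nil (e : ℕ) (w : List ℕ) : lx ((e + 1) :: w) [] = 0 := lx_cons_nil e w

/-- The right-hand side vanishes on the empty word. [folklore] -/
theorem Q_apply_nil (c : ℕ) (s' : List ℕ) (d : ℕ) (t'' : List ℕ) (hs : ∀ i ∈ s', 1 ≤ i)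
    (ht : ∀ i ∈ t'', 1 ≤ i) : Q ((c + 1) :: s') ((d + 1) :: t'') [] = 0 := by
  rw [Q, Pi.add_apply, Pi.add_apply, QA_cons, QB_cons, QC_cons_cons, finset_sum_apply_nil,
    finset_sum_apply_nil, list_sum_apply_nil]
  have hq : ∀ (e : ℕ) (w r : List ℕ) (y : ℕ) (q : List ℕ), (∀ i ∈ r, 1 ≤ i) →
      ((qshHead ((e + 1) :: w) r).map fun v => lxy v ((y + 1) :: q) []).sum = 0 := by
    intro e w r y q hr
    cases r with
    | nil => simp [lxy_succ_succ_nil]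
    | cons x r' =>
      have hx : 1 ≤ x := hr x (by simp)
      obtain ⟨x', rfl⟩ : ∃ x', x = x' + 1 := ⟨x - 1, by omega⟩
      simp only [qshHead_cons_cons, List.map_append, List.map_map, List.sum_append, Function.comp_def,
        lxy_succ_succ_nil, show e + 1 + (x' + 1) = (e + x' + 1) + 1 by ring, List.map_const',
        List.sum_replicate, smul_zero, add_zero]
  have hA : ∀ p ∈ splits t'', ((qshHead ((c + 1) :: s') p.2).map fun v => lxy v ((d + 1) :: p.1)).sum [] = 0 := by
    intro p hp
    rw [list_sum_apply_nil]
    exact hq c s' p.2 d p.1 fun i hi => ht i (mem_of_mem_splits_snd hp hi)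
  have hB : ∀ p ∈ splits s',
      ((qshHead ((d + 1) :: t'') p.2).map fun v => swapL (lxy v ((c + 1) :: p.1))).sum [] = 0 := by
    intro p hp
    rw [list_sum_apply_nil]
    simp only [swapL_apply, List.map_nil]
    exact hq d t'' p.2 c p.1 fun i hi => hs i (mem_of_mem_splits_snd hp hi)
  rw [Finset.sum_congr rfl hA, Finset.sum_congr rfl hB, Finset.sum_const_zero, Finset.sum_const_zero]
  simp only [show c + 1 + (d + 1) = (c + d + 1) + 1 by ring, lxyD_cons_nil, List.map_const',
    List.sum_replicate, smul_zero, add_zero]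

/-- **The series shuffle formula in `V(M_{0,5})`** [Furusho2011, §4, (series shuffle for bar)]:
for nonempty indices `s, t` with positive entries,
`l^x_s ш l^y_t = Σ_{σ ∈ Sh^≤(k,l)} l^{σ(x,y)}_{σ(𝐚,𝐛)} = Q(s, t)`
(e.g. `l^x_2 ш l^y_1 = l^{x,y}_{2,1} + l^{y,x}_{1,2} + l^{xy}_3`, [Furusho2011, Examples 4.1]). Furusho's
proof is analytic (the power series identity for `Li_𝐚(x) Li_𝐛(y)` transported by the embedding
`ρ : V(M_{0,5}) ↪ I_o(M_{0,5})`); this proof is by induction on the weight, comparing the outermost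
components `∂_f` of both sides: `∂_{α₀} Q = Q(𝐚⁻, 𝐛)`, `∂_{α₁} Q = Q(𝐚', 𝐛)`, `∂_γ Q = 0`, and the
`β`-components by the symmetry `x ↔ y`. [cite: Furusho2011, §4 (series shuffle formula for bar)] -/
theorem seriesShuffle : ∀ (N : ℕ) (c : ℕ) (s' : List ℕ) (d : ℕ) (t'' : List ℕ),
    (∀ i ∈ s', 1 ≤ i) → (∀ i ∈ t'', 1 ≤ i) → (c + 1) + s'.sum + (d + 1) + t''.sum ≤ N →
      shuf (lx ((c + 1) :: s')) (ly ((d + 1) :: t'')) = Q ((c + 1) :: s') ((d + 1) :: t'') := by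
  intro N
  induction N with
  | zero => intro c s' d t'' _ _ h; omega
  | succ N ih =>
    intro c s' d t'' hs ht hN
    -- the a-components, for any pair at this weight
    have ha0 : ∀ (c : ℕ) (s' : List ℕ) (d : ℕ) (t'' : List ℕ), (∀ i ∈ s', 1 ≤ i) → (∀ i ∈ t'', 1 ≤ i) →
        (c + 1) + s'.sum + (d + 1) + t''.sum ≤ N + 1 →
        der a0 (shuf (lx ((c + 1) :: s')) (ly ((d + 1) :: t''))) = der a0 (Q ((c + 1) :: s') ((d + 1) :: t'')) := by
      intro c s' d t'' hs ht hN
      rw [der_shuf]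
      rcases c with _ | c
      · rw [der_lx_one, if_neg (by decide), shuf_zero_left, zero_add, der_a0_Q_one s' t'' d ht]
        rcases d with _ | d
        · rw [der_ly_one, if_neg (by decide), shuf_comm, shuf_zero_left]
        · rw [der_ly_two, if_neg (by decide), shuf_comm, shuf_zero_left]
      · rw [der_lx_two, if_pos rfl, der_a0_Q_two, ih c s' d t'' hs ht (by omega)]
        rcases d with _ | d
        · rw [der_ly_one, if_neg (by decide), shuf_comm (lx _), shuf_zero_left, add_zero]
        · rw [der_ly_two, if_neg (by decide), shuf_comm (lx _), shuf_zero_left, add_zero]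
    have ha1 : ∀ (c : ℕ) (s' : List ℕ) (d : ℕ) (t'' : List ℕ), (∀ i ∈ s', 1 ≤ i) → (∀ i ∈ t'', 1 ≤ i) →
        (c + 1) + s'.sum + (d + 1) + t''.sum ≤ N + 1 →
        der a1 (shuf (lx ((c + 1) :: s')) (ly ((d + 1) :: t''))) = der a1 (Q ((c + 1) :: s') ((d + 1) :: t'')) := by
      intro c s' d t'' hs ht hN
      rw [der_shuf]
      have hy : der a1 (ly ((d + 1) :: t'')) = 0 := by
        rcases d with _ | d
        · rw [der_ly_one, if_neg (by decide)]
        · rw [der_ly_two, if_neg (by decide)]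
      rw [hy, shuf_comm (lx _), shuf_zero_left, add_zero]
      rcases c with _ | c
      · rw [der_lx_one, if_pos rfl]
        cases s' with
        | nil => rw [lx_nil, shuf_unit_left, der_a1_Q_one_nil t'' d ht]
        | cons c' s'' =>
          have hc' : 1 ≤ c' := hs c' (by simp)
          obtain ⟨c'', rfl⟩ : ∃ c'', c' = c'' + 1 := ⟨c' - 1, by omega⟩
          rw [der_a1_Q_one_cons t'' d ht,
            ih c'' s'' d t'' (fun i hi => hs i (by simp [hi])) ht (by simp at hN ⊢; omega)]
      · rw [der_lx_two, if_neg (by decide), shuf_zero_left, der_a1_Q_two]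
    refine ext_der ?_ fun f => ?_
    · rw [shuf_nil, lx_succ_cons_nil, zero_mul, Q_apply_nil c s' d t'' hs ht]
    cases f with
    | a0 => exact ha0 c s' d t'' hs ht hN
    | a1 => exact ha1 c s' d t'' hs ht hN
    | b0 =>
      -- by the symmetry x ↔ y
      have h := congrArg swapL (ha0 d t'' c s' ht hs (by omega))
      rw [der_eq_swapL_der_sw b0 (shuf _ _), der_eq_swapL_der_sw b0 (Q _ _), sw_b0, swapL_shuf,
        swapL_lx, swapL_ly, shuf_comm (ly _), swapL_Q]
      exact h
    | b1 =>
      have h := congrArg swapL (ha1 d t'' c s' ht hs (by omega))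
      rw [der_eq_swapL_der_sw b1 (shuf _ _), der_eq_swapL_der_sw b1 (Q _ _), sw_b1, swapL_shuf,
        swapL_lx, swapL_ly, shuf_comm (ly _), swapL_Q]
      exact h
    | g =>
      rw [der_shuf, der_g_Q]
      have hx : der g (lx ((c + 1) :: s')) = 0 := by
        rcases c with _ | c
        · rw [der_lx_one, if_neg (by decide)]
        · rw [der_lx_two, if_neg (by decide)]
      have hy : der g (ly ((d + 1) :: t'')) = 0 := by
        rcases d with _ | d
        · rw [der_ly_one, if_neg (by decide)]
        · rw [der_ly_two, if_neg (by decide)]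
      rw [hx, hy, shuf_zero_left, shuf_comm, shuf_zero_left, add_zero]

/-- **The series shuffle formula**, packaged: for nonempty `s, t` with positive entries,
`l^x_s ш l^y_t = Q(s, t)`. [cite: Furusho2011, §4 (series shuffle formula for bar)] -/
theorem shuf_lx_ly {s t : List ℕ} (hs : ∀ i ∈ s, 1 ≤ i) (ht : ∀ i ∈ t, 1 ≤ i) (hs0 : s ≠ [])
    (ht0 : t ≠ []) : shuf (lx s) (ly t) = Q s t := by
  obtain ⟨c, s', rfl⟩ := List.exists_cons_of_ne_nil hs0
  obtain ⟨d, t'', rfl⟩ := List.exists_cons_of_ne_nil ht0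
  have hc : 1 ≤ c := hs c (by simp)
  have hd : 1 ≤ d := ht d (by simp)
  obtain ⟨c, rfl⟩ : ∃ c₀, c = c₀ + 1 := ⟨c - 1, by omega⟩
  obtain ⟨d, rfl⟩ : ∃ d₀, d = d₀ + 1 := ⟨d - 1, by omega⟩
  exact seriesShuffle _ c s' d t'' (fun i hi => hs i (by simp [hi])) (fun i hi => ht i (by simp [hi])) le_rfl


end BarFun

end Literature.NumberTheory.Transcendental
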